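import Summits.QuantumFields.YangMills.Theorems.ColdStartUniversalityLatticeLangevinTimeAverageCLT
import Summits.QuantumFields.YangMills.Theorems.ColdStartUniversalityLatticeLangevinAsymptoticVariance
import Summits.QuantumFields.YangMills.Theorems.ColdStartUniversalityLatticeLangevinSplice
import HarnessLib

/-!
# Route `ColdStartUniversality` (fixed-cut-off SZZ dynamics, sampler package): ★★★ THE CLT WITH A BURN-IN — discarding any initial stretch
# `b_n = o(T_n)` and normalising by `√(T_n − b_n)` leaves the Gaussian limit unchanged

Helper file (seat `ym-line-csu-p1`, g35; `--supports stmt-QuantumFields-24809`).  Practitioners discard a burn-in before averaging.  For every strong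
solution `U` of the SU(2) SZZ dynamics from a deterministic start, every continuous `|G| ≤ 1`, every `T_n → ∞` and every burn-in `0 ≤ b_n` with
`b_n/T_n → 0`:

  `(T_n − b_n)^(−1/2) ∫_(b_n, T_n] (G(U_r) − μ_(β')G) dr  ⇒  N(0, σ²(G))`   (★★★ `timeAverage_clt_burnIn`),

with the same Green–Kubo variance `σ²(G)` as without burn-in (file 94c).  Proof: the discarded piece has second moment `≤ b_nσ² + K` (file 67,
`abs_integral_sq_centered_sub_greenKubo_le_of_solution`), hence `T_n^(−1/2)∫_(0,b_n] Ĝ → 0` in probability (Markov); Slutsky twice (difference,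
then the deterministic factor `√(T_n/(T_n − b_n)) → 1`); regular flow + pathwise uniqueness for measurability.  THEOREMS ONLY, no definition, no
sorry; [folklore].
HONEST FRAMING: fixed cut-off; `σ²(G)`, `K` depend on `L, β'`; the bias bound of file 100 shows the burn-in is not even needed asymptotically;
`UniformColdStartMixing` (24809) is NOT restated; no crux, rung or summit statement is proved; the Yang–Mills mass gap is NOT proved.
-/

set_option autoImplicit false

noncomputable section

namespace Summit.QuantumFields.YangMills.Theorems.ColdStartUniversality

open MeasureTheory ProbabilityTheory Filter Topology Set
open scoped NNReal ENNReal BigOperators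
open Literature Literature.Probability.Process Literature.MathematicalPhysics.QuantumFieldTheory
open Literature.MathematicalPhysics.QuantumLattice (fundamentalRep fundamentalLatticeRep continuous_fundamentalRep)

variable {L : ℕ} [NeZero L]

/-- ★★★ **CLT with burn-in** (see the module docstring): `(T_n − b_n)^(−1/2)∫_(b_n,T_n] Ĝ(U_r)dr ⇒ N(0, σ²(G))` whenever `T_n → ∞`, `0 ≤ b_n`,
`b_n/T_n → 0`; every strong solution from a deterministic start, every continuous `|G| ≤ 1` (fixed cut-off). [folklore] -/
theorem timeAverage_clt_burnIn (L : ℕ) [NeZero L] (β' : ℝ)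
    (κ : ℝ≥0 → Kernel (GaugeConfig 3 L (Matrix.specialUnitaryGroup (Fin 2) ℂ))
      (GaugeConfig 3 L (Matrix.specialUnitaryGroup (Fin 2) ℂ))) [∀ t, IsMarkovKernel (κ t)]
    (hreal : ∀ (t : ℝ≥0) (x : GaugeConfig 3 L (Matrix.specialUnitaryGroup (Fin 2) ℂ))
        (Ω : Type) [MeasurableSpace Ω] (P : Measure Ω) [IsProbabilityMeasure P]
        (W : ℝ≥0 → Ω → (Edge 3 L × NoiseIdx 2 → ℝ)) (hW : IsFlatBrownian W P)
        (U : ℝ≥0 → Ω → GaugeConfig 3 L (Matrix.specialUnitaryGroup (Fin 2) ℂ)),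
        (∀ ω, U 0 ω = x) →
        (latticeLangevinDynamics (fundamentalLatticeRep 2) β').IsSolution (fundamentalRep (Fin 2))
          hW.natFiltration P W U →
        κ t x = P.map (U t))
    (x : GaugeConfig 3 L (Matrix.specialUnitaryGroup (Fin 2) ℂ))
    {Ω : Type} [MeasurableSpace Ω] {P : Measure Ω} [IsProbabilityMeasure P]
    {W : ℝ≥0 → Ω → (Edge 3 L × NoiseIdx 2 → ℝ)} (hW : IsFlatBrownian W P)
    {U : ℝ≥0 → Ω → GaugeConfig 3 L (Matrix.specialUnitaryGroup (Fin 2) ℂ)} (hU0 : ∀ ω, U 0 ω = x)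
    (hU : (latticeLangevinDynamics (fundamentalLatticeRep 2) β').IsSolution (fundamentalRep (Fin 2)) hW.natFiltration P W U)
    {G : GaugeConfig 3 L (Matrix.specialUnitaryGroup (Fin 2) ℂ) → ℝ} (hGc : Continuous G) (hG1 : ∀ z, |G z| ≤ 1)
    {σ2 : ℝ} (hσ2 : σ2 = 2 * ∫ t in Ioi (0 : ℝ),
        (∫ y, (G y - ∫ z, G z ∂(wilsonMeasure (d := 3) (L := L) (fundamentalRep (Fin 2)) β')) *
          (∫ z, (G z - ∫ z', G z' ∂(wilsonMeasure (d := 3) (L := L) (fundamentalRep (Fin 2)) β')) ∂(κ t.toNNReal y))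
          ∂(wilsonMeasure (d := 3) (L := L) (fundamentalRep (Fin 2)) β')))
    (Ω' : Type) [MeasurableSpace Ω'] (P' : Measure Ω') [IsProbabilityMeasure P'] (Y : Ω' → ℝ)
    (hY : HasLaw Y (gaussianReal 0 σ2.toNNReal) P')
    (Tn bn : ℕ → ℝ) (hTn : Tendsto Tn atTop atTop) (hb0 : ∀ n, 0 ≤ bn n) (hbT : Tendsto (fun n => bn n / Tn n) atTop (𝓝 0)) :
    TendstoInDistribution (fun (n : ℕ) ω => (Real.sqrt (Tn n - bn n))⁻¹ * ∫ r in Ioc (bn n) (Tn n),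
        (G (U r.toNNReal ω) - ∫ z, G z ∂(wilsonMeasure (d := 3) (L := L) (fundamentalRep (Fin 2)) β'))) atTop Y (fun _ => P) P' := by
  classical
  haveI := secondCountableTopology_su2
  haveI := borelSpace_config L
  obtain ⟨hσ0, -, hclt⟩ := timeAverage_clt L β' κ hreal x hW hU0 hU hGc hG1 hσ2
  obtain ⟨K, hK, h67⟩ := abs_integral_sq_centered_sub_greenKubo_le_of_solution L β'
  set μ : Measure (GaugeConfig 3 L (Matrix.specialUnitaryGroup (Fin 2) ℂ)) :=
    wilsonMeasure (d := 3) (L := L) (fundamentalRep (Fin 2)) β' with hμ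
  set mG : ℝ := ∫ z, G z ∂μ with hmG
  have hGhm : Measurable fun z => G z - mG := hGc.measurable.sub measurable_const
  have hmG1 : |mG| ≤ 1 := by
    haveI : IsProbabilityMeasure μ :=
      isProbabilityMeasure_wilsonMeasure (d := 3) (L := L) (fundamentalRep (Fin 2)) (continuous_fundamentalRep (Fin 2)) β'
    have hh := norm_integral_le_of_norm_le_const (μ := μ) (f := G) (C := 1)
      (Eventually.of_forall fun z => by simpa [Real.norm_eq_abs] using hG1 z)
    simpa [Real.norm_eq_abs] using hh
  have hGhb : ∀ z, |G z - mG| ≤ 2 := fun z => (abs_sub _ _).trans (by linarith [hG1 z, hmG1])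
  set GK : ℝ := ∫ t in Ioi (0 : ℝ), (∫ y, (G y - mG) * (∫ z, (G z - mG) ∂(κ t.toNNReal y)) ∂μ) with hGK
  have hGK0 : 0 ≤ GK := by have : σ2 = 2 * GK := hσ2; linarith
  /- ### 1. Regular flow; the three statistics along `V` -/
  obtain ⟨V, -, hV, hVprog, -, -, -⟩ := exists_regularFlow L β' hW
  have hprog : ∀ i : ℝ≥0, Measurable[@Prod.instMeasurableSpace (Set.Iic i) Ω inferInstance (hW.natFiltration i)]
      (fun q : Set.Iic i × Ω => V x q.1 q.2) := fun i =>
    (hVprog i).comp (measurable_fst.prodMk (measurable_const.prodMk measurable_snd))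
  have hae : ∀ᵐ ω ∂P, ∀ t, U t ω = V x t ω := latticeLangevin_pathwise_unique hW β' x hU0 (hV x).1 hU (hV x).2
  have hpathm : Measurable fun p : Ω × ℝ => V x p.2.toNNReal p.1 :=
    measurable_uncurry_of_prog (Z := V x) (fun n : ℕ => hW.natFiltration n) (fun n => hW.natFiltration.le n) (fun n => hprog n)
  have hpath : ∀ ω (lo hi : ℝ), IntegrableOn (fun r : ℝ => G (V x r.toNNReal ω) - mG) (Ioc lo hi) volume := fun ω lo hi =>
    (integrableOn_const (C := (2 : ℝ)) (hs := measure_Ioc_lt_top.ne)).mono'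
      ((hGhm.comp (hpathm.comp (measurable_const.prodMk measurable_id))).aestronglyMeasurable)
      (Eventually.of_forall fun r => by rw [Real.norm_eq_abs]; exact hGhb _)
  have hIm : ∀ lo hi : ℝ, Measurable fun ω => ∫ r in Ioc lo hi, (G (V x r.toNNReal ω) - mG) := fun lo hi => by
    have h1 : Measurable (Function.uncurry fun (ω : Ω) (r : ℝ) => G (V x r.toNNReal ω) - mG) := hGhm.comp hpathm
    exact (h1.stronglyMeasurable.integral_prod_right' (ν := volume.restrict (Ioc lo hi))).measurable
  set XV : ℕ → Ω → ℝ := fun n ω => (Real.sqrt (Tn n))⁻¹ * ∫ r in Ioc (0 : ℝ) (Tn n), (G (V x r.toNNReal ω) - mG) with hXV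
  set WV : ℕ → Ω → ℝ := fun n ω => (Real.sqrt (Tn n))⁻¹ * ∫ r in Ioc (0 : ℝ) (bn n), (G (V x r.toNNReal ω) - mG) with hWV
  set ZV : ℕ → Ω → ℝ := fun n ω => (Real.sqrt (Tn n - bn n))⁻¹ * ∫ r in Ioc (bn n) (Tn n), (G (V x r.toNNReal ω) - mG) with hZV
  have hXVm : ∀ n, Measurable (XV n) := fun n => (hIm _ _).const_mul _
  have hWVm : ∀ n, Measurable (WV n) := fun n => (hIm _ _).const_mul _
  have hZVm : ∀ n, Measurable (ZV n) := fun n => (hIm _ _).const_mul _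
  have hcltV : TendstoInDistribution XV atTop Y (fun _ => P) P' := by
    refine (hclt Ω' P' Y hY Tn hTn).congr (fun n => ?_) (ae_eq_refl _)
    filter_upwards [hae] with ω hω
    simp only [hXV, hω]
  /- ### 2. The discarded piece is negligible: `W_n → 0` in probability -/
  have hsecond : ∀ n, ∫ ω, (∫ r in Ioc (0 : ℝ) (bn n), (G (V x r.toNNReal ω) - mG)) ^ 2 ∂P ≤ 2 * bn n * GK + K := fun n => by
    have h := h67 κ hreal x Ω P W hW (V x) (hV x).1 (hV x).2 G hGc hG1 (bn n) (hb0 n)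
    have := (abs_le.1 h).2
    linarith
  have hTpos : ∀ᶠ n in atTop, 0 < Tn n := hTn.eventually (eventually_gt_atTop 0)
  have hW0 : TendstoInMeasure P WV atTop fun _ => (0 : ℝ) := by
    rw [tendstoInMeasure_iff_measureReal_norm]
    intro ε hε
    have hbound : Tendsto (fun n => (2 * bn n * GK + K) / (ε ^ 2 * Tn n)) atTop (𝓝 0) := by
      have e : ∀ n, (2 * bn n * GK + K) / (ε ^ 2 * Tn n) = (2 * GK / ε ^ 2) * (bn n / Tn n) + (K / ε ^ 2) * (Tn n)⁻¹ := fun n => by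
        rcases eq_or_ne (Tn n) 0 with h0 | h0
        · simp [h0]
        · field_simp
      simp_rw [e]
      simpa using (hbT.const_mul (2 * GK / ε ^ 2)).add ((tendsto_inv_atTop_zero.comp hTn).const_mul (K / ε ^ 2))
    refine tendsto_of_tendsto_of_tendsto_of_le_of_le' tendsto_const_nhds hbound (Eventually.of_forall fun n => measureReal_nonneg) ?_
    filter_upwards [hTpos] with n hT
    have hsq : 0 < Real.sqrt (Tn n) := Real.sqrt_pos.2 hT
    -- `{ε ≤ |W_n|} = {ε² T_n ≤ I_n²}` and Markov
    have hset : {ω | ε ≤ ‖WV n ω - 0‖} ⊆ {ω | ε ^ 2 * Tn n ≤ (∫ r in Ioc (0 : ℝ) (bn n), (G (V x r.toNNReal ω) - mG)) ^ 2} := by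
      intro ω hω
      simp only [Set.mem_setOf_eq, sub_zero, hWV, Real.norm_eq_abs, abs_mul, abs_inv, abs_of_pos hsq] at hω ⊢
      have h1 : ε * Real.sqrt (Tn n) ≤ |∫ r in Ioc (0 : ℝ) (bn n), (G (V x r.toNNReal ω) - mG)| := by
        rw [inv_mul_eq_div, le_div_iff₀ hsq] at hω; exact hω
      have h2 := mul_self_le_mul_self (by positivity) h1
      rw [← sq_abs (∫ r in Ioc (0 : ℝ) (bn n), _)]
      nlinarith [Real.sq_sqrt hT.le]
    have hint : Integrable (fun ω => (∫ r in Ioc (0 : ℝ) (bn n), (G (V x r.toNNReal ω) - mG)) ^ 2) P := by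
      refine (integrable_const ((2 * bn n) ^ 2)).mono' ((hIm _ _).pow_const 2).aestronglyMeasurable (Eventually.of_forall fun ω => ?_)
      rw [Real.norm_eq_abs, abs_pow, sq_abs]
      have hh := norm_setIntegral_le_of_norm_le_const (μ := volume) (s := Ioc (0 : ℝ) (bn n)) measure_Ioc_lt_top
        (fun r _ => show ‖G (V x r.toNNReal ω) - mG‖ ≤ 2 by rw [Real.norm_eq_abs]; exact hGhb _)
      rw [Real.norm_eq_abs, Real.volume_real_Ioc_of_le (hb0 n), sub_zero] at hh
      have : |∫ r in Ioc (0 : ℝ) (bn n), (G (V x r.toNNReal ω) - mG)| ≤ 2 * bn n := by linarith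
      rw [← sq_abs]
      exact pow_le_pow_left₀ (abs_nonneg _) this 2
    have hmarkov := mul_meas_ge_le_integral_of_nonneg (Eventually.of_forall fun ω => sq_nonneg _) hint (ε ^ 2 * Tn n)
    have hεT : 0 < ε ^ 2 * Tn n := by positivity
    calc P.real {ω | ε ≤ ‖WV n ω - 0‖} ≤ P.real {ω | ε ^ 2 * Tn n ≤ (∫ r in Ioc (0 : ℝ) (bn n), (G (V x r.toNNReal ω) - mG)) ^ 2} :=
          measureReal_mono hset
      _ ≤ (∫ ω, (∫ r in Ioc (0 : ℝ) (bn n), (G (V x r.toNNReal ω) - mG)) ^ 2 ∂P) / (ε ^ 2 * Tn n) := by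
          rw [le_div_iff₀ hεT, mul_comm]; exact hmarkov
      _ ≤ (2 * bn n * GK + K) / (ε ^ 2 * Tn n) := by gcongr; exact hsecond n
  /- ### 3. Slutsky twice: `X_n − W_n ⇒ Y`, then the factor `√(T_n/(T_n − b_n)) → 1` -/
  have hdiffD : TendstoInDistribution (fun n ω => XV n ω - WV n ω) atTop Y (fun _ => P) P' := by
    refine tendstoInDistribution_of_tendstoInMeasure_sub (fun n ω => XV n ω - WV n ω) Y hcltV ?_
      (fun n => ((hXVm n).sub (hWVm n)).aemeasurable)
    have h : TendstoInMeasure P (fun n ω => -WV n ω) atTop fun _ => (0 : ℝ) := by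
      rw [tendstoInMeasure_iff_norm] at hW0 ⊢
      intro ε hε
      refine (hW0 ε hε).congr fun n => ?_
      congr 1; ext ω; simp
    refine h.congr (fun n => Eventually.of_forall fun ω => ?_) (ae_eq_refl _)
    simp only [Pi.sub_apply]; ring
  set c : ℕ → ℝ := fun n => Real.sqrt (Tn n) / Real.sqrt (Tn n - bn n) with hc
  have hbltT : ∀ᶠ n in atTop, bn n < Tn n := by
    filter_upwards [hTpos, hbT.eventually (gt_mem_nhds (by norm_num : (0 : ℝ) < 1))] with n hT hlt
    rwa [div_lt_one hT] at hlt
  have hc1 : Tendsto c atTop (𝓝 1) := by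
    have hlim : Tendsto (fun n => (Real.sqrt (1 - bn n / Tn n))⁻¹) atTop (𝓝 1) := by
      have h := ((hbT.const_sub 1).sqrt).inv₀ (by simp)
      simpa using h
    refine hlim.congr' ?_
    filter_upwards [hTpos, hbltT] with n hT hlt
    simp only [hc]
    rw [one_sub_div hT.ne', Real.sqrt_div' _ hT.le, inv_div]
  have hcdet : TendstoInMeasure P (fun n (_ : Ω) => c n) atTop fun _ => (1 : ℝ) := by
    rw [tendstoInMeasure_iff_norm]
    intro ε hε
    have hev : ∀ᶠ n in atTop, ‖c n - 1‖ < ε := (tendsto_iff_norm_sub_tendsto_zero.1 hc1).eventually (gt_mem_nhds hε)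
    refine tendsto_const_nhds.congr' ?_
    filter_upwards [hev] with n hn
    rw [show {ω : Ω | ε ≤ ‖c n - 1‖} = ∅ from Set.eq_empty_of_forall_notMem fun ω hω => (not_le.2 hn) hω, measure_empty]
  have hprodD : TendstoInDistribution (fun n ω => c n * (XV n ω - WV n ω)) atTop (fun ω' => 1 * Y ω') (fun _ => P) P' :=
    hdiffD.continuous_comp_prodMk_of_tendstoInMeasure_const (g := fun p : ℝ × ℝ => p.2 * p.1) (by fun_prop) hcdet
      (fun n => aemeasurable_const)
  simp only [one_mul] at hprodD
  /- ### 4. The burn-in statistic agrees with `c_n (X_n − W_n)` eventually; transfer to `U` -/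
  have hZVd : TendstoInDistribution ZV atTop Y (fun _ => P) P' := by
    refine tendstoInDistribution_of_tendstoInMeasure_sub ZV Y hprodD ?_ (fun n => (hZVm n).aemeasurable)
    have h0 : TendstoInMeasure P (fun (_ : ℕ) (_ : Ω) => (0 : ℝ)) atTop fun _ => (0 : ℝ) := by
      rw [tendstoInMeasure_iff_norm]
      intro ε hε
      have : {ω : Ω | ε ≤ ‖(0 : ℝ) - 0‖} = ∅ := Set.eq_empty_of_forall_notMem fun ω hω => by
        rw [Set.mem_setOf_eq, sub_zero, norm_zero] at hω; exact (not_le.2 hε) hω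
      simp only [this, measure_empty, tendsto_const_nhds]
    refine h0.congr' ?_ (ae_eq_refl _)
    filter_upwards [hTpos, hbltT] with n hT hlt
    refine Eventually.of_forall fun ω => ?_
    simp only [Pi.sub_apply, hZV, hXV, hWV, hc]
    have hsT : 0 < Real.sqrt (Tn n) := Real.sqrt_pos.2 hT
    have hsplit : ∫ r in Ioc (0 : ℝ) (Tn n), (G (V x r.toNNReal ω) - mG) =
        (∫ r in Ioc (0 : ℝ) (bn n), (G (V x r.toNNReal ω) - mG)) + ∫ r in Ioc (bn n) (Tn n), (G (V x r.toNNReal ω) - mG) := by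
      rw [← Ioc_union_Ioc_eq_Ioc (hb0 n) hlt.le, setIntegral_union (Ioc_disjoint_Ioc_of_le le_rfl) measurableSet_Ioc
        (hpath ω _ _) (hpath ω _ _)]
    have hsTb : 0 < Real.sqrt (Tn n - bn n) := Real.sqrt_pos.2 (by linarith)
    have hcc : Real.sqrt (Tn n) / Real.sqrt (Tn n - bn n) * (Real.sqrt (Tn n))⁻¹ = (Real.sqrt (Tn n - bn n))⁻¹ := by
      field_simp
    rw [hsplit, mul_add, add_sub_cancel_left, ← mul_assoc, hcc, sub_self]
  refine hZVd.congr (fun n => ?_) (ae_eq_refl _)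
  filter_upwards [hae] with ω hω
  simp only [hZV, hω]

end Summit.QuantumFields.YangMills.Theorems.ColdStartUniversality

end
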